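/-
Origin: expansion seat `planner-pub-hodgecm-pv09-g4-0`, handover #2 2026-08-18T07:11:37Z (`HOME/pub-hodgecm-pv09-g4/lean/Pv09g4/RallisHaarDomain.lean`, md5 2e56b2dd, 221 lines);
landed by the gen-7 packager in gate run 25 as `HodgeCM/PerL34/RallisHaarDomain.lean` (import ^import Pv[0-9]+g[0-9]+\.→import HodgeCM.PerL34. ×2).
-/
/-
HodgeCM / PerL34 publication cell — seam S3 (pub-hodgecm-pv09-g4, HANDOVER #2 (b)).
Imports: `Pv09g4.RallisHaar` (HANDOVER #1 ↦ `HodgeCM.PerL34.RallisHaar`) and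
`Pv09g4.DiscreteFundamentalDomain` (HANDOVER #2 (a) ↦ `HodgeCM.PerL34.DiscreteFundamentalDomain`).
Complete proofs, no new axioms, nothing cited.
-/
import Summits.HodgeConjecture.HodgeCM.PerL34.RallisHaar_2
import Summits.HodgeConjecture.HodgeCM.PerL34.DiscreteFundamentalDomain_2

/-!
# The fundamental domain of `U(W_i)(L₀)` in `U(W_i)(𝔸)` for the canonical Haar datum

The S3 end theorems `PureTensor.theta_ne_zero_rallis`, `PureTensor.theta_ne_zero_of_N31d`,
`PureTensor.thetaLift_ne_zero_of_N31d` (RallisHaar.lean) take a measurable fundamental domain `𝓕`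
of the rational points `jA.range = U(W_i)(L₀)` in `Πʳ_i [G_i, B_i] = U(W_i)(𝔸)` for the global Haar
measure of the Haar datum, of finite volume (`h𝓕`, `vol_ne_top`, `IsFiniteMeasure (μ.restrict 𝓕)`).
Here these are DISCHARGED from the two structural facts of the set-up — `U(W_i)(L₀)` is DISCRETE
and COCOMPACT in `U(W_i)(𝔸)` (anisotropy of the hermitian line) — by the general existence theorem
`DiscreteFD.exists_isFundamentalDomain_left_finite`:

* `exists_isFundamentalDomain_haarDatum` — for every discrete cocompact subgroup `Γ` of
  `Πʳ_i [G_i, B_i]`: a measurable, relatively compact fundamental domain for the Haar-datum measure,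
  of positive finite volume;
* `exists_domain_theta_ne_zero_rallis` — `theta_ne_zero_rallis` with the fundamental domain
  PRODUCED (the binders `h𝓕`, `vol_ne_top` gone): there is such an `𝓕` for which every `θ` whose
  norm is Rallis' double integral over `𝓕 × 𝓕` of the kernel is non-zero;
* `exists_domain_theta_ne_zero_of_N31d` — the same one node up (node N31d's print inputs).
-/

set_option autoImplicit false

noncomputable section

open MeasureTheory Set Filter Function Topology Complex ComplexConjugate

open scoped RestrictedProduct InnerProductSpace

namespace HodgeCM.PerL34.PureTensor

open HodgeCM.PerL34.AdelicFactorisation HodgeCM.PerL34.RestrictedMeasure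
  HodgeCM.PerL34.NoSmallSubgroups HodgeCM.PerL34.EulerFactorisation HodgeCM.PerL34.DiscreteFD

/-! ## §1 Fundamental domains of discrete cocompact subgroups for the Haar datum -/

section domain

variable {ι : Type} {G : ι → Type} [∀ i, CommGroup (G i)] [∀ i, TopologicalSpace (G i)]
  [∀ i, IsTopologicalGroup (G i)] [∀ i, T2Space (G i)] [∀ i, SecondCountableTopology (G i)]
  [∀ i, MeasurableSpace (G i)] [∀ i, BorelSpace (G i)] [Countable ι]
  (B : ∀ i, Subgroup (G i)) (hBc : ∀ i, IsCompact (B i : Set (G i)))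
  (hBo : ∀ i, IsOpen (B i : Set (G i))) (S₀ : Finset ι)

/-- **Fundamental domain of a discrete cocompact subgroup of `Πʳ_i [G_i, B_i]`** for the global Haar
measure of the Haar datum: measurable, relatively compact, of positive finite volume, and a
fundamental domain in the exact sense (one point of every orbit) hence for EVERY measure. -/
theorem exists_isFundamentalDomain_haarDatum (Γ : Subgroup (Πʳ i, [G i, B i]))
    [DiscreteTopology Γ] [CompactSpace ((Πʳ i, [G i, B i]) ⧸ Γ)] :
    ∃ 𝓕 : Set (Πʳ i, [G i, B i]), MeasurableSet 𝓕 ∧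
      (∀ x : Πʳ i, [G i, B i], ∃! γ : Γ, γ • x ∈ 𝓕) ∧
      IsFundamentalDomain Γ 𝓕 (haarDatum B hBc hBo S₀).μ ∧ IsCompact (closure 𝓕) ∧
      (haarDatum B hBc hBo S₀).μ 𝓕 ≠ 0 ∧ (haarDatum B hBc hBo S₀).μ 𝓕 ≠ ⊤ := by
  haveI : Fact (∀ i, IsOpen (B i : Set (G i))) := ⟨hBo⟩
  haveI : BorelSpace (Πʳ i, [G i, B i]) := borelSpace_rp B hBo
  haveI : SecondCountableTopology (Πʳ i, [G i, B i]) := secondCountableTopology_rp B hBo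
  haveI : LocallyCompactSpace (Πʳ i, [G i, B i]) := locallyCompactSpace_rp B hBc hBo
  haveI : Countable Γ := countable_of_discrete Γ
  obtain ⟨𝓕, h𝓕m, hc, h⟩ := exists_fundamentalDomain_left_relCompact Γ
  have hfd : IsFundamentalDomain Γ 𝓕 (haarDatum B hBc hBo S₀).μ :=
    isFundamentalDomain_of_existsUnique h𝓕m h _
  exact ⟨𝓕, h𝓕m, h, hfd, hc, haarDatum_vol_ne_zero_of_isFundamentalDomain B hBc hBo S₀ hfd,
    haarDatum_vol_ne_top_of_closure B hBc hBo S₀ hc⟩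

omit [∀ i, IsTopologicalGroup (G i)] [∀ i, T2Space (G i)] [∀ i, MeasurableSpace (G i)]
  [∀ i, BorelSpace (G i)] in
include hBo in
/-- Countability of a discrete subgroup of `Πʳ_i [G_i, B_i]` (second countability, pv09-g2). -/
theorem countable_of_discrete_rp (Γ : Subgroup (Πʳ i, [G i, B i])) [DiscreteTopology Γ] :
    Countable Γ := by
  haveI : SecondCountableTopology (Πʳ i, [G i, B i]) := secondCountableTopology_rp B hBo
  exact countable_of_discrete Γ

end domain

/-! ## §2 The S3 end theorem with the fundamental domain produced -/

section rallis

open HodgeCM.PerL34.RallisIP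

variable {ι : Type} {G : ι → Type} [∀ i, CommGroup (G i)] [∀ i, TopologicalSpace (G i)]
  [∀ i, IsTopologicalGroup (G i)] [∀ i, T2Space (G i)] [∀ i, SecondCountableTopology (G i)]
  [∀ i, LocallyCompactSpace (G i)] [∀ i, MeasurableSpace (G i)] [∀ i, BorelSpace (G i)]
  [Countable ι] [DecidableEq ι]
  (B : ∀ i, Subgroup (G i)) (hBc : ∀ i, IsCompact (B i : Set (G i)))
  (hBo : ∀ i, IsOpen (B i : Set (G i))) (S₀ : Finset ι)
  {Sp : Type} [NormedAddCommGroup Sp] [InnerProductSpace ℂ Sp]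
  {E : Type*} [NormedAddCommGroup E] [InnerProductSpace ℂ E]
  {L : Type*} [Field L] [StarRing L] {W : Type*} [AddCommGroup W] [Module L W]
  {H : Type*} [Group H] {h : W →ₗ⋆[L] W →ₗ[L] L} (hW : IsLine L W) (hh : Anisotropic h)
  (ιH : (Πʳ j, [G j, B j]) × (Πʳ j, [G j, B j]) →* H)
  (ω : (Πʳ j, [G j, B j]) →* (Sp ≃ₗᵢ[ℂ] Sp))
  (χV : (Πʳ j, [G j, B j]) →* ℂ) (norm_χV : ∀ a, ‖χV a‖ = 1)
  (jA : unitary L →* Πʳ j, [G j, B j]) (hjA : Function.Injective jA)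
  -- the two structural facts of the set-up: `U(W_i)(L₀)` discrete and cocompact in `U(W_i)(𝔸)`
  [DiscreteTopology (jA.range : Subgroup (Πʳ j, [G j, B j]))]
  [CompactSpace ((Πʳ j, [G j, B j]) ⧸ (jA.range : Subgroup (Πʳ j, [G j, B j])))]
  (j : isomBox h →* H) (hj : ∀ d : unitary L, j ⟨iotaSnd d, iotaSnd_mem h d⟩ = ιH (1, jA d))
  (χ : (Πʳ j, [G j, B j]) →* Circle) (hχΓ : ∀ d : unitary L, χ (jA d) = 1)
  (hχVΓ : ∀ d : unitary L, χV (jA d) = 1)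
  (φ : Sp) (fbox Eis : H → ℂ) (K : (Πʳ j, [G j, B j]) → (Πʳ j, [G j, B j]) → ℂ) (c : ℝ)
  (hbasic : ∀ h₁ h₂ : Πʳ j, [G j, B j], fbox (ιH (h₁, h₂)) = χV h₂ * inner ℂ (ω h₂ φ) (ω h₁ φ))
  (hPinv : ∀ p ∈ (stabDelta L W).subgroupOf (isomBox h), ∀ x : H, fbox (j p * x) = fbox x)
  (hEis : ∀ u u' : Πʳ j, [G j, B j], HasSum (eisTerm h j fbox hPinv (ιH (u, u')))
    (Eis (ιH (u, u'))))
  (hKE : ∀ u u' : Πʳ j, [G j, B j], K u u' = (c : ℂ) * (χV u')⁻¹ * Eis (ιH (u, u')))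
  (hφ : ‖φ‖ = 1)
  (hloc : ∀ (i : ι) (v : Sp), Continuous fun g : G i => ω (RestrictedProduct.mulSingle B i g) v)
  {T' : Finset ι} (hχT' : RestrictedProduct.boxSubgroup B T' ≤ χ.ker)
  (hlocχ : ∀ i ∈ T', Continuous fun g : G i => χ (RestrictedProduct.mulSingle B i g))
  {T : Finset ι} (hK : ∀ k ∈ RestrictedProduct.boxSubgroup B T, ω k φ = φ)
  (hM : ∀ S : Finset ι, T ⊆ S → ∀ y : (i : ↥S) → G i,
    inner ℂ φ (ω (extendOne B S y) φ) = ∏ i : ↥S, localCoeff B ω φ i (y i))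
  {S : Finset ι} {q : ι → ℕ} {chiPi nuPi : ι → ℂ} {IsSplit : ι → Prop}
  (X : UnramifiedPlaceData B (haarDatum B hBc hBo S₀) ω φ χ S q chiPi nuPi IsSplit)
  (hTS : T ⊆ S)
  (hclS : ∀ i ∈ S, Integrable (localCoeff B ω φ i) ((haarDatum B hBc hBo S₀).ν i))
  (hsum : Summable fun i : {j : ι // j ∉ S} => EulerProduct.tOf (q i.1))

include hW hh norm_χV hjA hj hχΓ hχVΓ hbasic hEis hKE hφ hloc hχT' hlocχ hK hM X hTS hclS hsum in
/-- **Non-vanishing of `θ`, fundamental domain PRODUCED.**  With `U(W_i)(L₀)` discrete and cocompact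
in `U(W_i)(𝔸)` there is a measurable, relatively compact fundamental domain `𝓕` of positive finite
Haar volume such that every vector `θ` (in any `Θ`) whose norm is Rallis' double integral of the
kernel `χ′(u) χ̄′(u′) K(u,u′)` over `𝓕 × 𝓕` is non-zero — `theta_ne_zero_rallis` with its binders
`h𝓕`, `vol_ne_top` discharged. -/
theorem exists_domain_theta_ne_zero_rallis (hT'S : T' ⊆ S) (c_pos : 0 < c)
    (ram_pos : ∀ i ∈ S, 0 < (localIntegrand B (haarDatum B hBc hBo S₀) ω φ χ i).I) :
    ∃ 𝓕 : Set (Πʳ j, [G j, B j]), MeasurableSet 𝓕 ∧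
      IsFundamentalDomain jA.range 𝓕 (haarDatum B hBc hBo S₀).μ ∧ IsCompact (closure 𝓕) ∧
      (haarDatum B hBc hBo S₀).μ 𝓕 ≠ 0 ∧ (haarDatum B hBc hBo S₀).μ 𝓕 ≠ ⊤ ∧
      ∀ (θ : E) (Θ : Set E), θ ∈ Θ →
        ⟪θ, θ⟫_ℂ = ∫ u in 𝓕, ∫ u' in 𝓕, ((χ u : Circle) : ℂ) * conj ((χ u' : Circle) : ℂ) *
          K u u' ∂(haarDatum B hBc hBo S₀).μ ∂(haarDatum B hBc hBo S₀).μ → θ ≠ 0 := by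
  haveI : Countable (jA.range : Subgroup (Πʳ j, [G j, B j])) :=
    countable_of_discrete_rp B hBo jA.range
  haveI : Countable (unitary L) := Countable.of_equiv _ (MonoidHom.ofInjective hjA).toEquiv.symm
  obtain ⟨𝓕, h𝓕m, -, hfd, hc, h0, htop⟩ :=
    exists_isFundamentalDomain_haarDatum B hBc hBo S₀ (jA.range : Subgroup (Πʳ j, [G j, B j]))
  exact ⟨𝓕, h𝓕m, hfd, hc, h0, htop, fun θ Θ hθ hnorm =>
    theta_ne_zero_rallis B hBc hBo S₀ hW hh ιH ω χV norm_χV jA hjA j hj hfd χ hχΓ hχVΓ φ fbox Eis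
      K c hbasic hPinv hEis hKE hφ hloc hχT' hlocχ hK hM X hTS hclS hsum hT'S c_pos htop θ Θ hθ
      hnorm ram_pos⟩

end rallis

/-! ## §3 One node up: node N31d's print inputs, fundamental domain produced -/

section n31d

open HodgeCM.PerL34.RallisIP HodgeCM.PerL34.Doubling HodgeCM.PerL34.N31d

variable {ι : Type} {G : ι → Type} [∀ i, CommGroup (G i)] [∀ i, TopologicalSpace (G i)]
  [∀ i, IsTopologicalGroup (G i)] [∀ i, T2Space (G i)] [∀ i, SecondCountableTopology (G i)]
  [∀ i, LocallyCompactSpace (G i)] [∀ i, MeasurableSpace (G i)] [∀ i, BorelSpace (G i)]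
  [Countable ι] [DecidableEq ι]
  (B : ∀ i, Subgroup (G i)) (hBc : ∀ i, IsCompact (B i : Set (G i)))
  (hBo : ∀ i, IsOpen (B i : Set (G i))) (S₀ : Finset ι)
  {Sp : Type} [NormedAddCommGroup Sp] [InnerProductSpace ℂ Sp]
  {E : Type*} [NormedAddCommGroup E] [InnerProductSpace ℂ E]
  {L : Type} [Field L] [StarRing L] {W : Type} [AddCommGroup W] [Module L W]
  {H Sbox : Type} [Group H] [AddCommGroup Sbox] [Module ℂ Sbox]
  {h : W →ₗ⋆[L] W →ₗ[L] L} (hW : IsLine L W) (hh : Anisotropic h)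
  (D : DoublingDatum (Πʳ j, [G j, B j]) H Sp Sbox) (GU : ThetaSide Sp Sbox)
  (jA : unitary L →* Πʳ j, [G j, B j]) (hjA : Function.Injective jA)
  [DiscreteTopology (jA.range : Subgroup (Πʳ j, [G j, B j]))]
  [CompactSpace ((Πʳ j, [G j, B j]) ⧸ (jA.range : Subgroup (Πʳ j, [G j, B j])))]
  (j : isomBox h →* H) (hj : ∀ d : unitary L, j ⟨iotaSnd d, iotaSnd_mem h d⟩ = D.ι (1, jA d))
  (χ : (Πʳ j, [G j, B j]) →* Circle) (hχΓ : ∀ d : unitary L, χ (jA d) = 1)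
  (hχVΓ : ∀ d : unitary L, D.χV (jA d) = 1)
  {hP : ∀ Ψ : Sbox, ∀ p ∈ (stabDelta L W).subgroupOf (isomBox h), ∀ x : H,
    D.fSW Ψ (j p * x) = D.fSW Ψ x}
  (P : GluePrintInputs D GU h j hP) (φ : Sp)
  (hφ : ‖φ‖ = 1)
  (hloc : ∀ (i : ι) (v : Sp), Continuous fun g : G i => D.ω (RestrictedProduct.mulSingle B i g) v)
  {T' : Finset ι} (hχT' : RestrictedProduct.boxSubgroup B T' ≤ χ.ker)
  (hlocχ : ∀ i ∈ T', Continuous fun g : G i => χ (RestrictedProduct.mulSingle B i g))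
  {T : Finset ι} (hK : ∀ k ∈ RestrictedProduct.boxSubgroup B T, D.ω k φ = φ)
  (hM : ∀ S : Finset ι, T ⊆ S → ∀ y : (i : ↥S) → G i,
    inner ℂ φ (D.ω (extendOne B S y) φ) = ∏ i : ↥S, localCoeff B D.ω φ i (y i))
  {S : Finset ι} {q : ι → ℕ} {chiPi nuPi : ι → ℂ} {IsSplit : ι → Prop}
  (X : UnramifiedPlaceData B (haarDatum B hBc hBo S₀) D.ω φ χ S q chiPi nuPi IsSplit)
  (hTS : T ⊆ S) (hT'S : T' ⊆ S)
  (hclS : ∀ i ∈ S, Integrable (localCoeff B D.ω φ i) ((haarDatum B hBc hBo S₀).ν i))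
  (hsum : Summable fun i : {j : ι // j ∉ S} => EulerProduct.tOf (q i.1))
  (ram_pos : ∀ i ∈ S, 0 < (localIntegrand B (haarDatum B hBc hBo S₀) D.ω φ χ i).I)

include hW hh hjA hj hχΓ hχVΓ P hφ hloc hχT' hlocχ hK hM X hTS hT'S hclS hsum ram_pos in
/-- **`θ ≠ 0` from node N31d's print inputs, fundamental domain PRODUCED** — `theta_ne_zero_of_N31d`
with `h𝓕`, `vol_ne_top` (and the countability of `U(W_i)(L₀)`) discharged from discreteness and
cocompactness of `U(W_i)(L₀)` in `U(W_i)(𝔸)`. -/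
theorem exists_domain_theta_ne_zero_of_N31d :
    ∃ 𝓕 : Set (Πʳ j, [G j, B j]), MeasurableSet 𝓕 ∧
      IsFundamentalDomain jA.range 𝓕 (haarDatum B hBc hBo S₀).μ ∧ IsCompact (closure 𝓕) ∧
      (haarDatum B hBc hBo S₀).μ 𝓕 ≠ 0 ∧ (haarDatum B hBc hBo S₀).μ 𝓕 ≠ ⊤ ∧
      ∀ (θ : E) (Θ : Set E), θ ∈ Θ →
        ⟪θ, θ⟫_ℂ = ∫ u in 𝓕, ∫ u' in 𝓕, ((χ u : Circle) : ℂ) * conj ((χ u' : Circle) : ℂ) *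
          thetaKernel D GU φ u u' ∂(haarDatum B hBc hBo S₀).μ ∂(haarDatum B hBc hBo S₀).μ →
        θ ≠ 0 := by
  haveI : Countable (jA.range : Subgroup (Πʳ j, [G j, B j])) :=
    countable_of_discrete_rp B hBo jA.range
  haveI : Countable (unitary L) := Countable.of_equiv _ (MonoidHom.ofInjective hjA).toEquiv.symm
  obtain ⟨𝓕, h𝓕m, -, hfd, hc, h0, htop⟩ :=
    exists_isFundamentalDomain_haarDatum B hBc hBo S₀ (jA.range : Subgroup (Πʳ j, [G j, B j]))
  exact ⟨𝓕, h𝓕m, hfd, hc, h0, htop, fun θ Θ hθ hnorm =>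
    theta_ne_zero_of_N31d B hBc hBo S₀ hW hh D GU jA hjA j hj hfd χ hχΓ hχVΓ P φ hφ hloc hχT'
      hlocχ hK hM X hTS hT'S hclS hsum htop θ Θ hθ hnorm ram_pos⟩

end n31d

end HodgeCM.PerL34.PureTensor

end
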